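import Summits.QuantumFields.BalabanUV.Beta.SpineRootedS0N
import Literature.MathematicalPhysics.QuantumFieldTheory.Balaban1983to89.Beta.RootedKernelReflection

/-!
# The Λ-PIECE of the `j = 0` spine obeys the PURE-SIGN reflection law (Sr): `elCol_bref`, `lamCoeffOf_reflect`, `SLam_reflect`,
# and `SLam Lc (lamCoeffOf (KInv Lc) Lc) (hessFFAt ctr Lc) κ′ (bref α κ′ u) = ε_{κ′} • refK (Φ Lc α) (SLam … κ′ u)`
# (β sub-cell, row BETA-an2, gen 14; AN2 §39.6 (c) / NOTE X-an2-45 §3 (iv): the third summand of hSrC at `j = 0`)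

HONEST FRAMING (cell charter, verbatim): «discharging BetaPertH makes Balaban's UV stability UNCONDITIONAL — a real
constructive-QFT result; it is NOT the continuum limit and NOT the Clay problem.»  DERIVED cell leaf (pub-balaban β sub-cell, lane
an2 gen 14); no statement of Bałaban's papers is typed here, no `[cite:]` tag, no `Prop` fact; it instantiates no binder of the
β-function wall by itself.  NOT `BetaPertH`; NOT continuum; NOT Clay.

## What is here ([folklore]; the reflection of axis `α` in an5's letters `bref`/`mref`/`R1`/`refK (Φ N α)`)

* §1 `bondDelta_eq_delta1`, **`elCol_bref`**: the column of the flat Wilson Hessian at the reflected bond is the reflected column,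
  `elCol κ′ (bref α κ′ u) a x = ε_{κ′} ε_a · elCol κ′ u a (bref α a x)` (an5's `smul_R1_delta1`, `curv_R1`, `curvAdj_R2`).
* §2 `lamCoeffOf_eq_tsum` (the box sum as a lattice sum) and **`lamCoeffOf_reflect`**: for a reflection-invariant packed kernel
  (`refK (Φ N α) K = K`, e.g. `KInv N` by an5's `refK_KInv`) the multiplier-response coefficients of the Lagrange stencil transform by
  pure signs, `lamCoeffOf K N μ (bref α μ y) κ′ (bref α κ′ u) = ε_{κ′} ε_μ · lamCoeffOf K N μ y κ′ u`.
* §3 **`SLam_reflect`**: pure-sign coefficients + a (Wr)-type table family `Q2 μ (bref α μ y) = ε_μ • refK Φ (Q2 μ y)` give the (Sr) law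
  `SLam N c Q2 κ′ (bref α κ′ u) = ε_{κ′} • refK Φ (SLam N c Q2 κ′ u)`.
* §4 THE Λ-PIECE: **`SLam_lamCoeffOf_hessFFAt_reflect`** (`Odd Lc`, centred root; an5's `hessFFAt_reflect` BY NAME) and the coefficient
  slices `S0At_lam_reflect` / `S0NAt_lam_reflect` (`S0At ρ_c 0 0 cΛ`, `S0NAt ρ_c 0 0 cΛ` obey (Sr) with NO contact) — the third input of the
  socket hSrC of `SpineRooted.axisReflectionCovariant_flipK_TbalOf_JsBalBmAtOf_ctrC` at `j = 0` (the vh-piece: `vhSAt_bref` +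
  `DiagonalContact`; the Wilson piece: an3's table, open).

All declarations `[folklore]`; axioms standard.  Provenance: b2b-balaban β sub-cell, unit beta-an2 gen 14, 2026-08-20 (v1); over an5's
`ResolventReflection`/`RootedKernelReflection`, an2's `BalabanStepJets`/`InterLevelTransport`/`SpineRootedS0(N)` BY NAME; no existing file touched.
-/

open Finset
open scoped BigOperators
open Literature.MathematicalPhysics.QuantumFieldTheory
open Literature.MathematicalPhysics.QuantumFieldTheory.Balaban1983to89
open Literature.MathematicalPhysics.QuantumFieldTheory.Balaban1983to89.Beta
open ExpKernelCalculus (MKer)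
open AffineAveraging (Form1 box toSite curv curvAdj)
open AveragingContoursRooted (ctr ctrOff)
open AveragingHessianKernelsRooted (hessFFAt)
open RootedKernelReflection (hessFFAt_reflect)
open KKTFluctuationKernel (delta1 delta1_apply)
open KernelSpecInstance (curv_smul curvAdj_smul)
open PolarizationSign (reflSign)
open KernelReflection (LegMap refK refK_apply)
open ResolventReflection (bref bref_bref mref mref_zsmul R1 R1_apply curv_R1 curvAdj_R2 smul_R1_delta1 Φ Φ_r_inl Φ_r_inr Φ_s_inl Φ_s_inr
  reflSign_mul_self refK_KInv)
open OneStepResolventKernel (Fib KInv)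
open InterLevelTransport (SLam cwsum cwsum_apply)
open BalabanStepJets (bondDelta elCol lamCoeffOf box1 elCol_eq_zero_of_not_mem_box1)

noncomputable section

namespace Summit.QuantumFields.BalabanUV.Beta.SpineRooted

variable {d : ℕ}

/-! ## §1 The flat Wilson column at a reflected bond -/

section ElCol

/-- [folklore] an2's elementary bond form is `delta1`. -/
theorem bondDelta_eq_delta1 (κ' : Fin (d + 1)) (u : Fin (d + 1) → ℤ) : bondDelta κ' u = delta1 κ' u := rfl

/-- [folklore] **THE FLAT WILSON COLUMN AT THE REFLECTED BOND IS THE REFLECTED COLUMN**: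
`elCol κ′ (bref α κ′ u) = ε_{κ′} • R1 α (elCol κ′ u)`. -/
theorem elCol_bref_eq (α κ' : Fin (d + 1)) (u : Fin (d + 1) → ℤ) :
    elCol κ' (bref α κ' u) = reflSign α κ' • R1 α (elCol κ' u) := by
  unfold BalabanStepJets.elCol
  rw [bondDelta_eq_delta1, bondDelta_eq_delta1, ← smul_R1_delta1, curv_smul, curvAdj_smul, curv_R1, curvAdj_R2]

/-- [folklore] Entrywise: `elCol κ′ (bref α κ′ u) a x = ε_{κ′} ε_a · elCol κ′ u a (bref α a x)`. -/
theorem elCol_bref (α κ' : Fin (d + 1)) (u : Fin (d + 1) → ℤ) (a : Fin (d + 1)) (x : Fin (d + 1) → ℤ) :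
    elCol κ' (bref α κ' u) a x = reflSign α κ' * reflSign α a * elCol κ' u a (bref α a x) := by
  rw [elCol_bref_eq, Pi.smul_apply, Pi.smul_apply, smul_eq_mul, R1_apply, mul_assoc]

end ElCol

/-! ## §2 The multiplier-response coefficients transform by pure signs -/

section Coeff

variable {N : ℕ}

/-- [folklore] The box sum defining `lamCoeffOf` as a lattice sum (the column vanishes off the box). -/
theorem lamCoeffOf_eq_tsum (K : MKer (d + 1) (Fib d)) (N : ℕ) (μ : Fin (d + 1)) (y : Fin (d + 1) → ℤ) (κ' : Fin (d + 1))
    (u : Fin (d + 1) → ℤ) :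
    lamCoeffOf K N μ y κ' u = ∑ a : Fin (d + 1), ∑' x : Fin (d + 1) → ℤ, K ((N : ℤ) • y) x (Sum.inr μ) (Sum.inl a) * elCol κ' u a x := by
  unfold BalabanStepJets.lamCoeffOf
  rw [Finset.sum_comm]
  refine Finset.sum_congr rfl fun a _ => ?_
  have hinj : Set.InjOn (fun v : Fin (d + 1) → ℤ => u + v) (box1 (d + 1) : Set (Fin (d + 1) → ℤ)) :=
    fun v _ w _ h => add_left_cancel h
  rw [← Finset.sum_image (f := fun x => K ((N : ℤ) • y) x (Sum.inr μ) (Sum.inl a) * elCol κ' u a x) hinj]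
  symm
  refine tsum_eq_sum fun x hx => ?_
  have hv : x - u ∉ box1 (d + 1) := by
    intro h
    exact hx (Finset.mem_image.2 ⟨x - u, h, by abel⟩)
  have h0 := elCol_eq_zero_of_not_mem_box1 (κ' := κ') (u := u) (α := a) hv
  rw [show u + (x - u) = x by abel] at h0
  rw [h0, mul_zero]

/-- [folklore] Entries of a reflection-invariant kernel on the multiplier–field block, at reflected arguments. -/
theorem apply_inr_inl_of_refK {K : MKer (d + 1) (Fib d)} {α : Fin (d + 1)} (hK : refK (Φ N α) K = K)
    (X Z : Fin (d + 1) → ℤ) (μ a : Fin (d + 1)) :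
    K X Z (Sum.inr μ) (Sum.inl a) = reflSign α μ * reflSign α a * K (mref N α μ X) (bref α a Z) (Sum.inr μ) (Sum.inl a) := by
  conv_lhs => rw [← hK]
  rw [refK_apply, Φ_s_inr, Φ_s_inl, Φ_r_inr, Φ_r_inl]

/-- [folklore] **THE MULTIPLIER-RESPONSE COEFFICIENTS TRANSFORM BY PURE SIGNS** under the reflection of axis `α`, for any
reflection-invariant packed kernel: `lamCoeffOf K N μ (bref α μ y) κ′ (bref α κ′ u) = ε_{κ′} ε_μ · lamCoeffOf K N μ y κ′ u`. -/
theorem lamCoeffOf_reflect {K : MKer (d + 1) (Fib d)} {α : Fin (d + 1)} (hK : refK (Φ N α) K = K) (μ : Fin (d + 1))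
    (y : Fin (d + 1) → ℤ) (κ' : Fin (d + 1)) (u : Fin (d + 1) → ℤ) :
    lamCoeffOf K N μ (bref α μ y) κ' (bref α κ' u) = reflSign α κ' * reflSign α μ * lamCoeffOf K N μ y κ' u := by
  rw [lamCoeffOf_eq_tsum, lamCoeffOf_eq_tsum, Finset.mul_sum]
  refine Finset.sum_congr rfl fun a _ => ?_
  rw [← Equiv.tsum_eq (Function.Involutive.toPerm (bref α a) (bref_bref α a)), ← tsum_mul_left]
  refine tsum_congr fun x => ?_
  simp only [Function.Involutive.coe_toPerm]
  rw [apply_inr_inl_of_refK hK, mref_zsmul, bref_bref, bref_bref, elCol_bref, bref_bref]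
  have h1 := reflSign_mul_self α a
  calc reflSign α μ * reflSign α a * K ((N : ℤ) • y) x (Sum.inr μ) (Sum.inl a) *
        (reflSign α κ' * reflSign α a * elCol κ' u a x)
      = (reflSign α a * reflSign α a) * (reflSign α κ' * reflSign α μ *
          (K ((N : ℤ) • y) x (Sum.inr μ) (Sum.inl a) * elCol κ' u a x)) := by ring
    _ = _ := by rw [h1, one_mul]

/-- [folklore] In particular for the packed one-step resolvent `KInv N` (an5's `refK_KInv`). -/
theorem lamCoeffOf_KInv_reflect [NeZero N] (α μ : Fin (d + 1)) (y : Fin (d + 1) → ℤ) (κ' : Fin (d + 1)) (u : Fin (d + 1) → ℤ) :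
    lamCoeffOf (KInv (N := N) (d := d)) N μ (bref α μ y) κ' (bref α κ' u) =
      reflSign α κ' * reflSign α μ * lamCoeffOf (KInv (N := N) (d := d)) N μ y κ' u :=
  lamCoeffOf_reflect (refK_KInv (N := N) α) μ y κ' u

end Coeff

/-! ## §3 The Lagrange stencil of pure-sign coefficients and covariant tables obeys (Sr) -/

section SLamReflect

variable {N : ℕ} [NeZero N]

/-- [folklore] **(Sr) FOR THE LAGRANGE STENCIL**: if the coefficients transform by pure signs and the table family by the (Wr)-type law,
then `SLam N c Q2 κ′ (bref α κ′ u) = ε_{κ′} • refK (Φ N α) (SLam N c Q2 κ′ u)`. -/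
theorem SLam_reflect {α : Fin (d + 1)} {c : Fin (d + 1) → (Fin (d + 1) → ℤ) → Fin (d + 1) → (Fin (d + 1) → ℤ) → ℝ}
    {Q2 : Fin (d + 1) → (Fin (d + 1) → ℤ) → MKer (d + 1) (Fib d)}
    (hc : ∀ μ y κ' u, c μ (bref α μ y) κ' (bref α κ' u) = reflSign α κ' * reflSign α μ * c μ y κ' u)
    (hQ : ∀ μ y, Q2 μ (bref α μ y) = reflSign α μ • refK (Φ N α) (Q2 μ y)) (κ' : Fin (d + 1)) (u : Fin (d + 1) → ℤ) :
    SLam N c Q2 κ' (bref α κ' u) = reflSign α κ' • refK (Φ N α) (SLam N c Q2 κ' u) := by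
  funext x z a b
  simp only [InterLevelTransport.SLam, Pi.smul_apply, smul_eq_mul, refK_apply, cwsum_apply, mul_neg, Finset.mul_sum]
  congr 1
  refine Finset.sum_congr rfl fun μ _ => ?_
  rw [← Equiv.tsum_eq (Function.Involutive.toPerm (bref α μ) (bref_bref α μ)), ← tsum_mul_left, ← tsum_mul_left]
  refine tsum_congr fun y => ?_
  simp only [Function.Involutive.coe_toPerm]
  rw [hc μ y κ' u, hQ μ y]
  simp only [Pi.smul_apply, smul_eq_mul, refK_apply]
  have h1 := reflSign_mul_self α μ
  calc reflSign α κ' * reflSign α μ * c μ y κ' u *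
        (reflSign α μ * ((Φ N α).s a * (Φ N α).s b * Q2 μ y ((Φ N α).r a x) ((Φ N α).r b z) a b))
      = (reflSign α μ * reflSign α μ) * (reflSign α κ' * ((Φ N α).s a * (Φ N α).s b *
          (c μ y κ' u * Q2 μ y ((Φ N α).r a x) ((Φ N α).r b z) a b))) := by ring
    _ = _ := by rw [h1, one_mul]

end SLamReflect

/-! ## §4 The Λ-piece of the `j = 0` spine: (Sr) with NO contact -/

section LambdaPiece

variable {Lc : ℕ} [NeZero Lc]

/-- [folklore] **THE Λ-PIECE OBEYS (Sr), PURE SIGN** (centred root, `Lc` odd):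
`SLam Lc (lamCoeffOf (KInv Lc) Lc) (hessFFAt ρ_c Lc) κ′ (bref α κ′ u) = ε_{κ′} • refK (Φ Lc α) (SLam … κ′ u)`. -/
theorem SLam_lamCoeffOf_hessFFAt_reflect (hLc : Odd Lc) (α κ' : Fin (d + 1)) (u : Fin (d + 1) → ℤ) :
    SLam Lc (lamCoeffOf (KInv (N := Lc) (d := d)) Lc) (fun μ y => hessFFAt (ctr (d + 1) Lc) Lc μ y) κ' (bref α κ' u) =
      reflSign α κ' • refK (Φ Lc α)
        (SLam Lc (lamCoeffOf (KInv (N := Lc) (d := d)) Lc) (fun μ y => hessFFAt (ctr (d + 1) Lc) Lc μ y) κ' u) :=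
  SLam_reflect (fun μ y κ'' u' => lamCoeffOf_KInv_reflect α μ y κ'' u') (fun μ y => hessFFAt_reflect hLc Lc α μ y) κ' u

/-- [folklore] **THE Λ-SLICE OF THE SPINE OBEYS (Sr) WITH NO CONTACT**: `S0At ρ_c 0 0 cΛ κ′ (bref α κ′ u) = ε_{κ′} • refK Φ (S0At ρ_c 0 0 cΛ κ′ u)`. -/
theorem S0At_lam_reflect (hLc : Odd Lc) (cΛ : ℝ) (α κ' : Fin (d + 1)) (u : Fin (d + 1) → ℤ) :
    S0At d Lc (ctr (d + 1) Lc) 0 0 cΛ κ' (bref α κ' u) = reflSign α κ' • refK (Φ Lc α) (S0At d Lc (ctr (d + 1) Lc) 0 0 cΛ κ' u) := by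
  have h := SLam_lamCoeffOf_hessFFAt_reflect (d := d) hLc α κ' u
  funext x z a b
  have hx := congrFun (congrFun (congrFun (congrFun h x) z) a) b
  simp only [Pi.smul_apply, smul_eq_mul, refK_apply] at hx
  simp only [S0At, Pi.add_apply, Pi.smul_apply, smul_eq_mul, zero_mul, zero_add, refK_apply, hx]
  ring

/-- [folklore] The same for the native-placement spine `S0NAt` (its Λ-slice IS `S0At`'s). -/
theorem S0NAt_lam_reflect (hLc : Odd Lc) (cΛ : ℝ) (α κ' : Fin (d + 1)) (u : Fin (d + 1) → ℤ) :
    S0NAt d Lc (ctr (d + 1) Lc) 0 0 cΛ κ' (bref α κ' u) = reflSign α κ' • refK (Φ Lc α) (S0NAt d Lc (ctr (d + 1) Lc) 0 0 cΛ κ' u) := by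
  rw [S0NAt_wl_eq_S0At_wl]
  exact S0At_lam_reflect hLc cΛ α κ' u

end LambdaPiece

end Summit.QuantumFields.BalabanUV.Beta.SpineRooted

end
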